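import Mathlib
import Literature.Combinatorics.Additive.TripleProductProperty

/-!
# Stub `stub_liveReduction` of line `Sketch` — crux `stmt-MatrixMultiplication-7359` (`SingleAutomatonRigidity`)

Route `MatrixMultiplication/AutomaticSTPPDesigns`, crux `stmt-MatrixMultiplication-7359`
(`Summit.MatrixMultiplication.MatrixMultiplication.Theses.AutomaticSTPPDesigns.SingleAutomatonRigidity`),
line `Sketch`, stub `stub_liveReduction`.

Reduction of the uniform bound `∑ᵢ (|Aᵢ||Bᵢ||Cᵢ|)^{2/3} < c |H|` for an arbitrary STPP family in a
finite abelian group `H` to the same bound for *live* families (every block `Aᵢ, Bᵢ, Cᵢ` nonempty):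
a dead block contributes `0 ^ (2/3) = 0` to the sum, and the live sub-family, indexed by the subtype
`{i // (A i).Nonempty ∧ (B i).Nonempty ∧ (C i).Nonempty}`, is again STPP (the one-clause form
`Literature.Combinatorics.Additive.addSimultaneousTPP_iff_forall` restricts along the injection
`Subtype.val`).
-/

set_option linter.dupNamespace false

namespace Summit.MatrixMultiplication.MatrixMultiplication.Theorems.SingleAutomatonRigidity

open Finset
open Literature.Combinatorics.Additive

/-- Restricting an (additive, abelian) STPP family along an injective reindexing map `e : κ → ι`
gives again an STPP family. -/
theorem addSimultaneousTPP_comp_of_injective {H : Type*} [AddCommGroup H] {ι κ : Type*}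
    (A B C : ι → Finset H) (hS : AddSimultaneousTPP A B C) {e : κ → ι}
    (he : Function.Injective e) :
    AddSimultaneousTPP (fun i => A (e i)) (fun i => B (e i)) (fun i => C (e i)) := by
  rw [addSimultaneousTPP_iff_forall] at hS ⊢
  intro i j k s hs s' hs' t ht t' ht' u hu u' hu' h0
  obtain ⟨hij, hjk, rest⟩ := hS (e i) (e j) (e k) s hs s' hs' t ht t' ht' u hu u' hu' h0
  exact ⟨he hij, he hjk, rest⟩

/-- **Live reduction.** Let `(Aᵢ, Bᵢ, Cᵢ)ᵢ` be an STPP family in a finite abelian group `H`. If the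
bound `∑ᵢ (|A'ᵢ||B'ᵢ||C'ᵢ|)^{2/3} < c |H|` holds for every STPP family in `H` all of whose blocks are
nonempty, then it holds for `(Aᵢ, Bᵢ, Cᵢ)ᵢ`: dead blocks contribute `0` (`0 ^ (2/3) = 0`), and the
live sub-family (indexed by the subtype of live indices) is again STPP. -/
theorem stub_liveReduction {H : Type} [AddCommGroup H] [Fintype H] {ι : Type} [Fintype ι]
    (A B C : ι → Finset H) (hS : AddSimultaneousTPP A B C) (c : ℝ)
    (h : ∀ (κ : Type) [Fintype κ] (A' B' C' : κ → Finset H),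
      (∀ i, (A' i).Nonempty ∧ (B' i).Nonempty ∧ (C' i).Nonempty) → AddSimultaneousTPP A' B' C' →
        ∑ i, (((A' i).card * (B' i).card * (C' i).card : ℕ) : ℝ) ^ ((2 : ℝ) / 3) <
          c * (Fintype.card H : ℝ)) :
    ∑ i, (((A i).card * (B i).card * (C i).card : ℕ) : ℝ) ^ ((2 : ℝ) / 3) <
      c * (Fintype.card H : ℝ) := by
  classical
  -- the live indices
  set P : ι → Prop := fun i => (A i).Nonempty ∧ (B i).Nonempty ∧ (C i).Nonempty with hP
  -- the live sub-family is STPP (restriction along `Subtype.val`)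
  have hS' : AddSimultaneousTPP (fun i : {i // P i} => A i.1) (fun i => B i.1) (fun i => C i.1) :=
    addSimultaneousTPP_comp_of_injective A B C hS Subtype.val_injective
  have hlive : ∀ i : {i // P i}, (A i.1).Nonempty ∧ (B i.1).Nonempty ∧ (C i.1).Nonempty :=
    fun i => i.2
  have key := h {i // P i} (fun i => A i.1) (fun i => B i.1) (fun i => C i.1) hlive hS'
  -- dead blocks contribute `0`
  have hdead : ∀ i, ¬ P i →
      (((A i).card * (B i).card * (C i).card : ℕ) : ℝ) ^ ((2 : ℝ) / 3) = 0 := by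
    intro i hi
    have h0 : (A i).card * (B i).card * (C i).card = 0 := by
      simp only [hP, not_and_or, Finset.not_nonempty_iff_eq_empty] at hi
      rcases hi with h1 | h1 | h1 <;> simp [h1]
    rw [h0, Nat.cast_zero, Real.zero_rpow (by norm_num)]
  -- pass from `∑ i : ι` to the live indices, then to the subtype
  have hsum : ∑ i, (((A i).card * (B i).card * (C i).card : ℕ) : ℝ) ^ ((2 : ℝ) / 3) =
      ∑ i ∈ Finset.univ.filter P,
        (((A i).card * (B i).card * (C i).card : ℕ) : ℝ) ^ ((2 : ℝ) / 3) :=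
    (Finset.sum_filter_of_ne fun i _ hne => not_not.1 fun hi => hne (hdead i hi)).symm
  rw [hsum, Finset.sum_subtype (Finset.univ.filter P) (p := P) (fun i => by simp)]
  exact key

end Summit.MatrixMultiplication.MatrixMultiplication.Theorems.SingleAutomatonRigidity
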